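import Mathlib
import HarnessLib
import Literature.Computability.AlgebraicComplexity.PatternExpressions
import Literature.Computability.AlgebraicComplexity.ValiantClasses
import Literature.Computability.AlgebraicComplexity.ValiantClassesProofs
import Literature.Computability.AlgebraicComplexity.QPBoundedClosure
import Literature.Computability.AlgebraicComplexity.GateQuotients
import Summits.ValiantsHypothesis.ValiantsHypothesis.Theorems.MonotoneRestorationOrbitCompressionQPNarrowClosureSums
import Summits.ValiantsHypothesis.ValiantsHypothesis.Theorems.MonotoneRestorationOrbitRestorationLinearVolumeQPHomogeneous

/-!
# Route MonotoneRestoration — aside `OrbitCompressionQP` (stmt-ValiantsHypothesis-18332), line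
# `expression_compression`: HOMOGENEOUS NORMAL FORM of `stub_narrowExpressionCompression`

Helper file (`--supports stmt-ValiantsHypothesis-18332`), def-free.  The open, `VP`-load-bearing stub of
the line says: a matrix-symmetric `VP` family presented by narrow labelled pattern expressions of SOME length
is presented by narrow expressions of quasi-polynomial LENGTH ("NQP").  Every structural use of `VP` on the
"one syntactic object" the line card asks for (depth reduction, coefficient extraction) starts from a
HOMOGENEOUS polynomial; this file shows the reduction to that case costs nothing:

* `exists_value_eq_homogeneousComponent` — ★ LABEL-PRESERVING HOMOGENISATION of labelled pattern expressions:
  for every `e : PatternExpr ℂ k l` and level `n` there are expressions `h j : PatternExpr ℂ k l` (`j ∈ ℕ`,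
  SAME label sorts) whose value at every assignment is the degree-`j` component of the value of `e`
  (edges have degree `1`, constants degree `0`, sums and label-summations componentwise, products by the
  Cauchy formula `DepthReduction.homogeneousComponent_mul`); `exists_close_eq_homogeneousComponent` — hence
  the degree-`j` component of a closed expression is a closed expression with the same labels: the
  hypothesis "narrow of some length" passes to homogeneous components with the SAME constant;
* `homogeneousComponent_rename_perm` — homogeneous components of matrix-symmetric polynomials are
  matrix-symmetric; `VP` passes to components by
  `OrbitRestorationLinearVolumeQPHomogeneous.isVPFamily_homogeneousComponent` (BCS Lemma 21.25);
* ★ `narrowExpressionCompression_iff_homogeneous` — **the stub holds iff it holds for HOMOGENEOUS families**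
  (`f_n` homogeneous of some degree `d_n` for every `n`).  Backward direction by the HARDEST-COMPONENT
  SELECTION: `μ(n,d)` = least `M` such that `f_n^{(d)}` has a closed expression with `n^(k+l) ≤ M` and
  length `≤ M` (exists for `n ≥ 1` by homogenising the given narrow expression of `f_n`); the family
  `h_n := f_n^{(d*_n)}`, `d*_n` maximising `μ(n,·)` over `d ≤ deg f_n`, is ONE homogeneous matrix-symmetric
  `VP` family with narrow expressions, so the homogeneous stub makes `μ(n, d*_n)` — hence every `μ(n,d)` —
  quasi-polynomial, UNIFORMLY in `d`; then `NarrowClosure.narrowQP_sum` re-assembles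
  `f_n = Σ_{d ≤ deg f_n} f_n^{(d)}` (`deg f_n + 1` summands, p-bounded).

Honest label: a normal form for an open aside (VH-free bookkeeping); no stub of the line is closed;
`OrbitCompressionQP`, the route and VP ≠ VNP are NOT moved.  References: Bürgisser–Clausen–Shokrollahi 1997,
Lemma 21.25; Dawar–Pago–Seppelt 2025 §5; Dwivedi–Pago–Seppelt 2026 §1.
-/

noncomputable section

-- `Summit.ValiantsHypothesis.ValiantsHypothesis.…` is the tree's single-conjunct layout (Sub = Summit).
set_option linter.dupNamespace false

namespace Summit.ValiantsHypothesis.ValiantsHypothesis.Theorems.OrbitCompressionQPHomogeneous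

open Literature.Computability.AlgebraicComplexity MvPolynomial
open Literature.Computability.AlgebraicComplexity.PatternExpr
open Summit.ValiantsHypothesis.ValiantsHypothesis.Theorems

/-! ### Label-preserving homogenisation of labelled pattern expressions -/

section Homogenisation

variable {k l : ℕ}

/-- ★ **Homogenisation.**  For every labelled pattern expression `e` with `k` row and `l` column labels and
every level `n` there is a sequence `h : ℕ → PatternExpr ℂ k l` (same label sorts) with
`value (h j) ρ γ = (value e ρ γ)^{(j)}` for all `j` and all assignments `ρ, γ`. [folklore] -/
theorem exists_value_eq_homogeneousComponent (n : ℕ) (e : PatternExpr ℂ k l) :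
    ∃ h : ℕ → PatternExpr ℂ k l, ∀ (j : ℕ) (ρ : Fin k → Fin n) (γ : Fin l → Fin n),
      value n (h j) ρ γ = homogeneousComponent j (value n e ρ γ) := by
  induction e with
  | edge a b =>
    refine ⟨fun j => if j = 1 then edge a b else const 0, fun j ρ γ => ?_⟩
    show value n (if j = 1 then edge a b else const 0) ρ γ = homogeneousComponent j (value n (edge a b) ρ γ)
    rw [value_edge, homogeneousComponent_of_mem
      ((mem_homogeneousSubmodule _ _).2 (isHomogeneous_X ℂ (ρ a, γ b)))]
    by_cases hj : j = 1
    · subst hj; simp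
    · rw [if_neg hj, if_neg hj, value_const, C_0]
  | const c =>
    refine ⟨fun j => if j = 0 then const c else const 0, fun j ρ γ => ?_⟩
    show value n (if j = 0 then const c else const 0) ρ γ = homogeneousComponent j (value n (const c) ρ γ)
    rw [value_const, homogeneousComponent_of_mem
      ((mem_homogeneousSubmodule _ _).2 (isHomogeneous_C (Fin n × Fin n) c))]
    by_cases hj : j = 0
    · subst hj; simp
    · rw [if_neg hj, if_neg hj, value_const, C_0]
  | add e₁ e₂ ih₁ ih₂ =>
    obtain ⟨h₁, hh₁⟩ := ih₁
    obtain ⟨h₂, hh₂⟩ := ih₂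
    exact ⟨fun j => add (h₁ j) (h₂ j), fun j ρ γ => by rw [value_add, hh₁, hh₂, value_add, map_add]⟩
  | mul e₁ e₂ ih₁ ih₂ =>
    obtain ⟨h₁, hh₁⟩ := ih₁
    obtain ⟨h₂, hh₂⟩ := ih₂
    -- `P j i = Σ_{t ≤ i} h₁ t * h₂ (j - t)`
    let P : ℕ → ℕ → PatternExpr ℂ k l := fun j i =>
      Nat.rec (mul (h₁ 0) (h₂ j)) (fun t acc => add acc (mul (h₁ (t + 1)) (h₂ (j - (t + 1))))) i
    have hP : ∀ (j i : ℕ) (ρ : Fin k → Fin n) (γ : Fin l → Fin n), value n (P j i) ρ γ =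
        ∑ t ∈ Finset.range (i + 1), homogeneousComponent t (value n e₁ ρ γ) *
          homogeneousComponent (j - t) (value n e₂ ρ γ) := by
      intro j i ρ γ
      induction i with
      | zero => simp [P, hh₁, hh₂]
      | succ i ih =>
        rw [Finset.sum_range_succ, ← ih]
        simp [P, hh₁, hh₂]
    refine ⟨fun j => P j j, fun j ρ γ => ?_⟩
    rw [hP, value_mul, DepthReduction.homogeneousComponent_mul]
  | sumRow a e ih =>
    obtain ⟨h, hh⟩ := ih
    exact ⟨fun j => sumRow a (h j), fun j ρ γ => by simp only [value_sumRow, hh, map_sum]⟩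
  | sumCol b e ih =>
    obtain ⟨h, hh⟩ := ih
    exact ⟨fun j => sumCol b (h j), fun j ρ γ => by simp only [value_sumCol, hh, map_sum]⟩

/-- Hence **the degree-`j` component of a closed expression is a closed expression with the same labels**.
[folklore] -/
theorem exists_close_eq_homogeneousComponent {n : ℕ} (e : PatternExpr ℂ k l) (j : ℕ) :
    ∃ e' : PatternExpr ℂ k l, e'.close n = homogeneousComponent j (e.close n) := by
  obtain ⟨h, hh⟩ := exists_value_eq_homogeneousComponent n e
  refine ⟨h j, ?_⟩
  unfold PatternExpr.close
  simp only [map_sum, hh]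

end Homogenisation

/-- **Homogeneous components of matrix-symmetric polynomials are matrix-symmetric**: taking the degree-`d`
component commutes with the renaming `x_ij ↦ x_{σ i, τ j}`. [folklore] -/
theorem homogeneousComponent_rename_perm {n : ℕ} (σ τ : Equiv.Perm (Fin n)) (d : ℕ)
    (p : MvPolynomial (Fin n × Fin n) ℂ) :
    homogeneousComponent d (rename (fun q : Fin n × Fin n => (σ q.1, τ q.2)) p) =
      rename (fun q : Fin n × Fin n => (σ q.1, τ q.2)) (homogeneousComponent d p) := by
  have key : ∀ i : ℕ, homogeneousComponent d
      (rename (fun q : Fin n × Fin n => (σ q.1, τ q.2)) (homogeneousComponent i p)) =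
        if d = i then rename (fun q : Fin n × Fin n => (σ q.1, τ q.2)) (homogeneousComponent i p)
        else 0 :=
    fun i => homogeneousComponent_of_mem ((mem_homogeneousSubmodule _ _).2
      ((homogeneousComponent_isHomogeneous i p).rename_isHomogeneous))
  calc homogeneousComponent d (rename (fun q : Fin n × Fin n => (σ q.1, τ q.2)) p)
      = homogeneousComponent d (rename (fun q : Fin n × Fin n => (σ q.1, τ q.2))
          (∑ i ∈ Finset.range (p.totalDegree + 1), homogeneousComponent i p)) := by
        rw [sum_homogeneousComponent]
    _ = ∑ i ∈ Finset.range (p.totalDegree + 1), homogeneousComponent d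
          (rename (fun q : Fin n × Fin n => (σ q.1, τ q.2)) (homogeneousComponent i p)) := by
        rw [map_sum, map_sum]
    _ = homogeneousComponent d
          (rename (fun q : Fin n × Fin n => (σ q.1, τ q.2)) (homogeneousComponent d p)) := by
        refine Finset.sum_eq_single d (fun i _ hi => ?_) (fun hd => ?_)
        · rw [key i, if_neg (Ne.symm hi)]
        · have hlt : p.totalDegree < d := by
            simpa [Finset.mem_range, Nat.lt_succ_iff] using hd
          rw [homogeneousComponent_eq_zero _ _ hlt, map_zero, map_zero]
    _ = rename (fun q : Fin n × Fin n => (σ q.1, τ q.2)) (homogeneousComponent d p) := by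
        rw [key d, if_pos rfl]

/-! ### The normal form -/

/-- ★ **HOMOGENEOUS NORMAL FORM of `stub_narrowExpressionCompression`.**  The stub (verbatim, left) holds
if and only if it holds for HOMOGENEOUS families (right: the same statement under the extra hypothesis
that `f_n` is homogeneous of some degree `d_n` for every `n`).  Backward direction: hardest-component
selection and re-assembly by `NarrowClosure.narrowQP_sum`, see the file header. [cite: DawarPagoSeppelt2025, §5] -/
theorem narrowExpressionCompression_iff_homogeneous :
    (∀ f : (n : ℕ) → MvPolynomial (Fin n × Fin n) ℂ,
      (∀ (n : ℕ) (σ τ : Equiv.Perm (Fin n)),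
        MvPolynomial.rename (fun p : Fin n × Fin n => (σ p.1, τ p.2)) (f n) = f n) →
      IsVPFamily f →
      (∃ c : ℕ, ∀ n : ℕ, 1 ≤ n → ∃ (k l : ℕ) (e : PatternExpr ℂ k l),
        n ^ (k + l) ≤ 2 ^ ((Nat.log 2 n + c) ^ c) ∧ e.close n = f n) →
      ∃ c : ℕ, ∀ n : ℕ, 1 ≤ n → ∃ (k l : ℕ) (e : PatternExpr ℂ k l),
        n ^ (k + l) ≤ 2 ^ ((Nat.log 2 n + c) ^ c) ∧ e.length ≤ 2 ^ ((Nat.log 2 n + c) ^ c) ∧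
        e.close n = f n) ↔
    (∀ f : (n : ℕ) → MvPolynomial (Fin n × Fin n) ℂ,
      (∃ d : ℕ → ℕ, ∀ n, (f n).IsHomogeneous (d n)) →
      (∀ (n : ℕ) (σ τ : Equiv.Perm (Fin n)),
        MvPolynomial.rename (fun p : Fin n × Fin n => (σ p.1, τ p.2)) (f n) = f n) →
      IsVPFamily f →
      (∃ c : ℕ, ∀ n : ℕ, 1 ≤ n → ∃ (k l : ℕ) (e : PatternExpr ℂ k l),
        n ^ (k + l) ≤ 2 ^ ((Nat.log 2 n + c) ^ c) ∧ e.close n = f n) →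
      ∃ c : ℕ, ∀ n : ℕ, 1 ≤ n → ∃ (k l : ℕ) (e : PatternExpr ℂ k l),
        n ^ (k + l) ≤ 2 ^ ((Nat.log 2 n + c) ^ c) ∧ e.length ≤ 2 ^ ((Nat.log 2 n + c) ^ c) ∧
        e.close n = f n) := by
  constructor
  · exact fun H f _ hsymm hVP hnarrow => H f hsymm hVP hnarrow
  intro H f hsymm hVP hnarrow
  classical
  obtain ⟨c₀, hc₀⟩ := hnarrow
  -- the three hypotheses pass to every family of homogeneous components `n ↦ f_n^{(d n)}`
  have hnarrow_comp : ∀ d : ℕ → ℕ, ∃ c : ℕ, ∀ n : ℕ, 1 ≤ n → ∃ (k l : ℕ) (e : PatternExpr ℂ k l),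
      n ^ (k + l) ≤ 2 ^ ((Nat.log 2 n + c) ^ c) ∧ e.close n = homogeneousComponent (d n) (f n) := by
    intro d
    refine ⟨c₀, fun n hn => ?_⟩
    obtain ⟨k, l, e, hkl, he⟩ := hc₀ n hn
    obtain ⟨e', he'⟩ := exists_close_eq_homogeneousComponent (n := n) e (d n)
    exact ⟨k, l, e', hkl, by rw [he', he]⟩
  have hsymm_comp : ∀ (d : ℕ → ℕ) (n : ℕ) (σ τ : Equiv.Perm (Fin n)),
      rename (fun p : Fin n × Fin n => (σ p.1, τ p.2)) (homogeneousComponent (d n) (f n)) =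
        homogeneousComponent (d n) (f n) := by
    intro d n σ τ
    rw [← homogeneousComponent_rename_perm, hsymm]
  have hVP_comp : ∀ d : ℕ → ℕ, IsVPFamily fun n => homogeneousComponent (d n) (f n) :=
    OrbitRestorationLinearVolumeQPHomogeneous.isVPFamily_homogeneousComponent f hVP
  -- the measure `μ n d`
  have hex : ∀ n d : ℕ, ∃ M : ℕ, 1 ≤ n → ∃ (k l : ℕ) (e : PatternExpr ℂ k l),
      n ^ (k + l) ≤ M ∧ e.length ≤ M ∧ e.close n = homogeneousComponent d (f n) := by
    intro n d
    rcases Nat.eq_zero_or_pos n with hn | hn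
    · exact ⟨0, fun h => absurd hn (by omega)⟩
    · obtain ⟨k, l, e, -, he⟩ := hc₀ n hn
      obtain ⟨e', he'⟩ := exists_close_eq_homogeneousComponent (n := n) e d
      exact ⟨max (n ^ (k + l)) e'.length, fun _ =>
        ⟨k, l, e', le_max_left _ _, le_max_right _ _, by rw [he', he]⟩⟩
  let μ : ℕ → ℕ → ℕ := fun n d => Nat.find (hex n d)
  have hμ_spec : ∀ n d : ℕ, 1 ≤ n → ∃ (k l : ℕ) (e : PatternExpr ℂ k l),
      n ^ (k + l) ≤ μ n d ∧ e.length ≤ μ n d ∧ e.close n = homogeneousComponent d (f n) :=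
    fun n d => Nat.find_spec (hex n d)
  have hμ_min : ∀ (n d M : ℕ), (1 ≤ n → ∃ (k l : ℕ) (e : PatternExpr ℂ k l),
      n ^ (k + l) ≤ M ∧ e.length ≤ M ∧ e.close n = homogeneousComponent d (f n)) → μ n d ≤ M :=
    fun n d M hM => Nat.find_min' (hex n d) hM
  -- the hardest component per level
  have hmax : ∀ n : ℕ, ∃ d : ℕ, ∀ d' : ℕ, d' ≤ (f n).totalDegree → μ n d' ≤ μ n d := by
    intro n
    obtain ⟨d, -, hd⟩ := Finset.exists_max_image (Finset.range ((f n).totalDegree + 1)) (μ n)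
      ⟨0, Finset.mem_range.2 (Nat.succ_pos _)⟩
    exact ⟨d, fun d' hd' => hd d' (Finset.mem_range.2 (Nat.lt_succ_of_le hd'))⟩
  choose dstar hdstar using hmax
  obtain ⟨c₁, hc₁⟩ := H (fun n => homogeneousComponent (dstar n) (f n))
    ⟨dstar, fun n => homogeneousComponent_isHomogeneous (dstar n) (f n)⟩
    (hsymm_comp dstar) (hVP_comp dstar) (hnarrow_comp dstar)
  -- every component is narrow of quasi-polynomial length, UNIFORMLY in the degree
  have hμQ : ∀ n : ℕ, 1 ≤ n → ∀ d : ℕ, d ≤ (f n).totalDegree →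
      μ n d ≤ 2 ^ ((Nat.log 2 n + c₁) ^ c₁) := by
    intro n hn d hd
    refine (hdstar n d hd).trans (hμ_min n (dstar n) _ fun _ => ?_)
    obtain ⟨k, l, e, hkl, hlen, he⟩ := hc₁ n hn
    exact ⟨k, l, e, hkl, hlen, he⟩
  -- re-assembly `f_n = Σ_{d ≤ deg f_n} f_n^{(d)}`
  have hm : ∃ c : ℕ, ∀ n : ℕ, (f n).totalDegree + 1 ≤ 2 ^ ((Nat.log 2 n + c) ^ c) :=
    (IsPBounded.add_holds hVP.1.2 (IsPBounded.const 1)).isQPBounded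
  obtain ⟨c₂, hc₂⟩ := NarrowClosure.narrowQP_sum (fun n => (f n).totalDegree + 1)
    (fun n d => homogeneousComponent d (f n)) hm
    ⟨c₁, fun n hn d hd => by
      obtain ⟨k, l, e, h1, h2, h3⟩ := hμ_spec n d hn
      exact ⟨k, l, e, h1.trans (hμQ n hn d (by omega)), h2.trans (hμQ n hn d (by omega)), h3⟩⟩
  refine ⟨c₂, fun n hn => ?_⟩
  obtain ⟨k, l, e, h1, h2, h3⟩ := hc₂ n hn
  exact ⟨k, l, e, h1, h2, h3.trans (sum_homogeneousComponent (f n))⟩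

/-- The useful direction, packaged: the homogeneous case of the stub implies the stub verbatim. [cite: DawarPagoSeppelt2025, §5] -/
theorem narrowExpressionCompression_of_homogeneous
    (H : ∀ f : (n : ℕ) → MvPolynomial (Fin n × Fin n) ℂ,
      (∃ d : ℕ → ℕ, ∀ n, (f n).IsHomogeneous (d n)) →
      (∀ (n : ℕ) (σ τ : Equiv.Perm (Fin n)),
        MvPolynomial.rename (fun p : Fin n × Fin n => (σ p.1, τ p.2)) (f n) = f n) →
      IsVPFamily f →
      (∃ c : ℕ, ∀ n : ℕ, 1 ≤ n → ∃ (k l : ℕ) (e : PatternExpr ℂ k l),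
        n ^ (k + l) ≤ 2 ^ ((Nat.log 2 n + c) ^ c) ∧ e.close n = f n) →
      ∃ c : ℕ, ∀ n : ℕ, 1 ≤ n → ∃ (k l : ℕ) (e : PatternExpr ℂ k l),
        n ^ (k + l) ≤ 2 ^ ((Nat.log 2 n + c) ^ c) ∧ e.length ≤ 2 ^ ((Nat.log 2 n + c) ^ c) ∧
        e.close n = f n) :
    ∀ f : (n : ℕ) → MvPolynomial (Fin n × Fin n) ℂ,
      (∀ (n : ℕ) (σ τ : Equiv.Perm (Fin n)),
        MvPolynomial.rename (fun p : Fin n × Fin n => (σ p.1, τ p.2)) (f n) = f n) →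
      IsVPFamily f →
      (∃ c : ℕ, ∀ n : ℕ, 1 ≤ n → ∃ (k l : ℕ) (e : PatternExpr ℂ k l),
        n ^ (k + l) ≤ 2 ^ ((Nat.log 2 n + c) ^ c) ∧ e.close n = f n) →
      ∃ c : ℕ, ∀ n : ℕ, 1 ≤ n → ∃ (k l : ℕ) (e : PatternExpr ℂ k l),
        n ^ (k + l) ≤ 2 ^ ((Nat.log 2 n + c) ^ c) ∧ e.length ≤ 2 ^ ((Nat.log 2 n + c) ^ c) ∧
        e.close n = f n :=
  narrowExpressionCompression_iff_homogeneous.2 H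

end Summit.ValiantsHypothesis.ValiantsHypothesis.Theorems.OrbitCompressionQPHomogeneous

end
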